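import Summits.BirchSwinnertonDyer.BirchSwinnertonDyer.Theses.ResidualThetaTransportAtTwo
import Summits.BirchSwinnertonDyer.BirchSwinnertonDyer.Theorems.ResidualThetaTransportAtTwoThetaLayerLambdaCongruenceAtTwoCosocleKanPlus
import HarnessLib

/-!
# Line `birth` for crux `ThetaLayerLambdaCongruenceAtTwo` (stmt-BirchSwinnertonDyer-20688, route ResidualThetaTransportAtTwo) —
# PROPOSED skeleton v14′ (width seat bsd-wall-rtt-p3-w3 g10; NOT registered — the LEAD / pen decide): ONE stub, the CURVE-LEVEL
# COSOCLE STATEMENT (Galois-free, pairing-free), DECISION-AGNOSTIC w.r.t. the typing of Buzzard's Prop. 2.4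

Skeleton of record is v13 (sha16 3820413dc2cd5167): {`stub_heckeSelfDual` (SD, item 27800), `stub_buzzard` (Bz, item 27798)}, composition
`thetaLayerLambdaCongruenceAtTwo_of_sdBz`. The crux meets print at EXACTLY ONE statement about the tree's own objects: for `W/ℚ` globally minimal
with `GoodSS W 2`, every odd level `L` with all `p ∤ 2L` good, and every maximal `𝔪 ∋ 2` of `𝕋 = HeckeRing0 L 2` with `|𝕋/𝔪| = 2` and
`T_q − a_q(W) ∈ 𝔪` (`q ∤ L`): `dim_{𝕋/𝔪} Λ/𝔪Λ = 2` (`Λ = periodHomologyHecke L = H₁(X₀(L); ℤ)`) — «cosocle multiplicity one at the mod-`2`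
eigen-ideals». Landed (this seat): `thetaLayerLambdaCongruenceAtTwo_of_cosocleW : (that statement) → Kan⁺` (p649433; FLAT from the CLOSED node).
The stub is discharged
* under the CURRENT typing of Buzzard (Albanese coordinate) by `cosocleW_of_aliasInputs h27800 h27798` (`…CosocleOfSelfDual`, p651011:
  SD ∧ Bz ⟹ stub; so v14′ is never worse than v13), and
* under the PICARD typing (Buzzard's own «via Picard functoriality»; reviewer of p648238 + rtt-p3-w4 g5 + w5 g8 concur on the mathematics) by
  `cosocleAtEigenIdeal_of_cosocleFact h27798′` ALONE — item 27800 (SD) and the intersection-pairing port then leave the closing path.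
ONE stub (≤ stubs_max), a print-level interface, NO research stub; BSD is not proved by this; nothing here is a theorem of the tree (the stub is `sorry`).
Companion proposal v14 (`Lines/birth_v14_w3g10.lean`): the stub spelled as Buzzard's Prop. 2.4 in the Picard reading.

References: [Buzzard2000LevelLoweringModTwo] Prop. 2.4; [DarmonDiamondTaylor1995] §1.3, §4.5; [LangeBirkenhake1992] Prop. 5.2.3, 5.2.6; [Pollack2003]
Conj. 6.3, Prop. 6.18; [GreenbergVatsal2000] §3 (13).
-/

set_option autoImplicit false
-- justification: the `Summit.BirchSwinnertonDyer.BirchSwinnertonDyer.…` path repeats a component (route-file convention)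
set_option linter.dupNamespace false

noncomputable section

open scoped MatrixGroups ModularForm NumberField
open CongruenceSubgroup Polynomial IsDedekindDomain Rat.HeightOneSpectrum
  Literature.NumberTheory.EllipticCurves.Rank1Residual Literature.NumberTheory.EllipticCurves.ModularForms
  Summit.BirchSwinnertonDyer.BirchSwinnertonDyer.Theses.ResidualThetaTransportAtTwo

namespace Summit.BirchSwinnertonDyer.BirchSwinnertonDyer.Cruxes.ThetaLayerLambdaCongruenceAtTwo.Birth

/-- (COS) PRINT-LEVEL STUB — cosocle multiplicity one at the mod-`2` eigen-ideals of good-supersingular-at-`2` curves at odd levels: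
`dim_{𝕋/𝔪} Λ/𝔪Λ = 2`. = hypothesis `hcosW` of `thetaLayerLambdaCongruenceAtTwo_of_cosocleW`. Discharges: `cosocleW_of_aliasInputs h27800 h27798`
(items 27800 ∧ 27798 as typed) or `cosocleAtEigenIdeal_of_cosocleFact h` (Buzzard Prop. 2.4 read on `J[2] = Hom(Λ, ℤ/2)`). Never a research target.
[cite: Buzzard2000LevelLoweringModTwo, Prop. 2.4 and Def. 2.1–2.2 (p. 100–101)] [cite: DarmonDiamondTaylor1995, §4.5 Thm. 4.26 (pp. 133–134)] -/
theorem stub_cosocleMultOne :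
    ∀ (W : WeierstrassCurve ℚ) [W.IsElliptic] [W.IsGloballyMinimal], GoodSS W 2 →
      ∀ (L : ℕ) [NeZero L], Odd L →
      (∀ v : HeightOneSpectrum (𝓞 ℚ), ¬ ((primesEquiv v : ℕ) ∣ 2 * L) → W.HasGoodReductionAt v) →
      ∀ (𝔪 : Ideal (HeckeRing0 L 2)), 𝔪.IsMaximal → (2 : HeckeRing0 L 2) ∈ 𝔪 → Nat.card (HeckeRing0 L 2 ⧸ 𝔪) = 2 →
      (∀ (q : ℕ) (hq : q.Prime), ¬ q ∣ L → HeckeRing0.T L 2 q hq - (W.LFunction q : HeckeRing0 L 2) ∈ 𝔪) →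
      Module.finrank (HeckeRing0 L 2 ⧸ 𝔪)
        (periodHomologyHecke L ⧸ (𝔪 • ⊤ : Submodule (HeckeRing0 L 2) (periodHomologyHecke L))) = 2 := by
  sorry

/-- THE SKELETON THEOREM (registrar shape): the crux BY NAME from the ONE stub through the LANDED sorry-free road
`thetaLayerLambdaCongruenceAtTwo_of_cosocleW` (p649433). [cite: Pollack2003, Conj. 6.3 and Prop. 6.18] -/
theorem ThetaLayerLambdaCongruenceAtTwo_of :
    Summit.BirchSwinnertonDyer.BirchSwinnertonDyer.Theses.ResidualThetaTransportAtTwo.ThetaLayerLambdaCongruenceAtTwo :=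
  Summit.BirchSwinnertonDyer.BirchSwinnertonDyer.Theorems.ThetaLayerLambdaCongruenceAtTwo.thetaLayerLambdaCongruenceAtTwo_of_cosocleW
    stub_cosocleMultOne

end Summit.BirchSwinnertonDyer.BirchSwinnertonDyer.Cruxes.ThetaLayerLambdaCongruenceAtTwo.Birth

end
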